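import Mathlib.LinearAlgebra.BilinearForm.Properties
import Mathlib.LinearAlgebra.Matrix.Determinant.Basic
import Mathlib.Algebra.BigOperators.Fin
import Mathlib.LinearAlgebra.Span.Basic
import Mathlib.Tactic.Module
import HarnessLib

/-!
# Witt's chain-equivalence theorem and the invariance of Hasse-type products

Topic `NumberTheory/QuadraticForms`; namespace `Literature.NumberTheory.QuadraticForms`. Everything here is
proved; no number theory is used.

Let `K` be a field with `2 ≠ 0`, `W` a `K`-vector space with a symmetric bilinear form `B`, and
`s : K → K → ℤ` an abstract **Hasse symbol** (`IsHasseSymbol`): symmetric, bimultiplicative on `Kˣ`,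
`±1`-valued, and invariant on binary forms (`⟨a, b⟩ ≅ ⟨a', b'⟩ ⇒ s a b = s a' b'`, in the concrete
form `a' = a x² + b y²`, `a' b' = a b c²`). A *frame* is a finite family `f : Fin k → W` of pairwise
`B`-orthogonal vectors of nonzero square (`IsFrame`), i.e. an orthogonal basis of its span, and its
*Hasse product* is `hasseProd s (B (f i) (f i))ᵢ = ∏_{i<j} s (fᵢ.fᵢ) (fⱼ.fⱼ)`.

This file sets up the vocabulary and the bookkeeping lemmas; the invariance theorem itself
(Serre, *A Course in Arithmetic*, Ch. IV §2.1 Thm. 5, via Witt's chain equivalence Ch. IV §1.4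
Thm. 2) is `hasseProd_eq_of_span_eq` in `HasseInvariantFramesWitt.lean`. Contents:

* `hasseProd`, `hasseProd_eq_succAbove` (removing one index:
  `ε(e) = (a₁, a₂ ⋯ aₙ) ∏_{2 ≤ i < j} (aᵢ, aⱼ)` at an arbitrary position), square-class invariance;
* `IsHasseSymbol` and its consequences (`mul_right`, `mul_sq_left/right`, `map_prod_right`);
* `IsFrame`: coefficients `w = ∑ (w.fⱼ/fⱼ.fⱼ) fⱼ` of a vector of the span, nondegeneracy of the
  span, `w.w = ∑ cⱼ² (fⱼ.fⱼ)`;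
* `exists_prod_eq_prod_mul_sq`: the discriminant of a frame is well defined up to squares
  (`diag(a') = P diag(a) ᵗP`);
* `IsFrame.update`, `IsFrame.update_update`: replacing one or two vectors of a frame.

The theory is stated for an abstract symbol so that it can be applied to Serre's explicit local
symbols `(a, b)_v` of `ℚ` (Ch. III Thm. 1), place by place, in the proof that the signature of an
even unimodular lattice is divisible by `8` (Ch. V §2.1 Thm. 2, Remark 2).

## References

* J.-P. Serre, *A Course in Arithmetic*, GTM 7, Springer 1973, Ch. IV §1.4 (Def. 6, Thm. 2; PDF
  pp. 29–30), §2.1 (Thm. 5; PDF pp. 33–34). [Serre1973]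
-/

namespace Literature.NumberTheory.QuadraticForms

open Finset Module

section HasseProd

variable {K : Type*}

/-- The **Hasse product** of a family `a : Fin k → K` with respect to a symbol `s`:
`∏_{i<j} s (a i) (a j)` (Serre's `ε(e) = ∏_{i<j} (aᵢ, aⱼ)` for the squares `aᵢ = eᵢ.eᵢ` of an
orthogonal basis `e`). [cite: Serre1973, Ch. IV §2.1] -/
def hasseProd (s : K → K → ℤ) {k : ℕ} (a : Fin k → K) : ℤ :=
  ∏ i, ∏ j, if i < j then s (a i) (a j) else 1

/-- The Hasse product of the empty family is `1`. [folklore] -/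
@[simp] theorem hasseProd_zero (s : K → K → ℤ) (a : Fin 0 → K) : hasseProd s a = 1 := by
  simp [hasseProd]

/-- The Hasse product of a singleton family is `1`. [folklore] -/
@[simp] theorem hasseProd_one (s : K → K → ℤ) (a : Fin 1 → K) : hasseProd s a = 1 := by
  simp [hasseProd]

/-- The Hasse product of a pair is the symbol: `hasseProd s (a₀, a₁) = s a₀ a₁`. [folklore] -/
@[simp] theorem hasseProd_two (s : K → K → ℤ) (a : Fin 2 → K) : hasseProd s a = s (a 0) (a 1) := by
  simp [hasseProd, Fin.prod_univ_two]

/-- **Removing one index from a Hasse product** (symmetric symbol): for `i : Fin (k+1)`,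
`∏_{l<j} s aₗ aⱼ = (∏_{j ≠ i} s aᵢ aⱼ) · ∏_{l<j, l,j ≠ i} s aₗ aⱼ`, the second factor being the Hasse
product of the family with `i` removed (`a ∘ i.succAbove`). This is the bookkeeping step
`ε(e) = (a₁, a₂ ⋯ aₙ) ∏_{2 ≤ i < j} (aᵢ, aⱼ)` of Serre's proof of Ch. IV §2.1 Thm. 5, at an arbitrary
position `i`. [cite: Serre1973, Ch. IV §2.1 Thm. 5] -/
theorem hasseProd_eq_succAbove {s : K → K → ℤ} (hcomm : ∀ a b, s a b = s b a) {k : ℕ}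
    (a : Fin (k + 1) → K) (i : Fin (k + 1)) :
    hasseProd s a = (∏ j : Fin k, s (a i) (a (i.succAbove j))) *
      hasseProd s (fun j => a (i.succAbove j)) := by
  unfold hasseProd
  rw [Fin.prod_univ_succAbove _ i]
  -- the row of `i`
  have hrow : (∏ j, if i < j then s (a i) (a j) else 1) =
      ∏ j : Fin k, if i < i.succAbove j then s (a i) (a (i.succAbove j)) else 1 := by
    rw [Fin.prod_univ_succAbove _ i, if_neg (lt_irrefl i), one_mul]
  -- the other rows
  have hrows : ∀ l : Fin k, (∏ j, if i.succAbove l < j then s (a (i.succAbove l)) (a j) else 1) =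
      (if i.succAbove l < i then s (a (i.succAbove l)) (a i) else 1) *
        ∏ j : Fin k, if l < j then s (a (i.succAbove l)) (a (i.succAbove j)) else 1 := by
    intro l
    rw [Fin.prod_univ_succAbove _ i]
    congr 1
    refine prod_congr rfl fun j _ => ?_
    simp only [Fin.succAbove_lt_succAbove_iff]
  rw [hrow, prod_congr rfl fun l _ => hrows l, prod_mul_distrib, ← mul_assoc]
  congr 1
  rw [← prod_mul_distrib]
  refine prod_congr rfl fun j _ => ?_
  rcases lt_or_gt_of_ne (Fin.succAbove_ne i j) with h | h
  · rw [if_neg (not_lt.mpr h.le), if_pos h, one_mul, hcomm]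
  · rw [if_pos h, if_neg (not_lt.mpr h.le), mul_one]

end HasseProd

variable {K : Type*} [Field K]

/-! ### Abstract Hasse symbols and the Hasse product -/

/-- An abstract **Hasse symbol** on a field `K`: a function `s : K → K → ℤ` which on nonzero
arguments is symmetric, multiplicative in the first (hence each) variable, `±1`-valued
(`s a b * s a b = 1`), and takes the same value on isomorphic binary forms: if `a' = a x² + b y²` is
a nonzero value of `⟨a, b⟩` and `a' b' = a b c²` (same discriminant), then `s a b = s a' b'`. These
are exactly the properties of the Hilbert symbol used in Serre's proof that
`ε = ∏_{i<j} (aᵢ, aⱼ)` is an invariant (Ch. IV §2.1 Thm. 5: symmetry, bilinearity, and the rank-`2`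
case "`ε(e) = 1` iff `a₁X² + a₂Y²` represents `1`, which does not depend on `e`").
[cite: Serre1973, Ch. IV §2.1 Thm. 5] -/
structure IsHasseSymbol (s : K → K → ℤ) : Prop where
  /-- symmetry `s a b = s b a` -/
  comm : ∀ a b : K, s a b = s b a
  /-- multiplicativity in the first variable on nonzero elements -/
  mul_left : ∀ a a' b : K, a ≠ 0 → a' ≠ 0 → b ≠ 0 → s (a * a') b = s a b * s a' b
  /-- the values on nonzero elements are `±1` -/
  mul_self : ∀ a b : K, a ≠ 0 → b ≠ 0 → s a b * s a b = 1
  /-- invariance on isomorphic binary forms `⟨a, b⟩ ≅ ⟨a', b'⟩` -/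
  binary : ∀ a b a' b' x y c : K, a ≠ 0 → b ≠ 0 → a' ≠ 0 → b' ≠ 0 → c ≠ 0 →
    a' = a * x ^ 2 + b * y ^ 2 → a' * b' = a * b * c ^ 2 → s a b = s a' b'

namespace IsHasseSymbol

variable {s : K → K → ℤ} (hs : IsHasseSymbol s)
include hs

/-- Multiplicativity in the second variable. [cite: Serre1973, Ch. IV §2.1 Thm. 5] -/
theorem mul_right (a b b' : K) (ha : a ≠ 0) (hb : b ≠ 0) (hb' : b' ≠ 0) :
    s a (b * b') = s a b * s a b' := by
  rw [hs.comm, hs.mul_left b b' a hb hb' ha, hs.comm b, hs.comm b']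

/-- A Hasse symbol only depends on square classes: `s (a c²) b = s a b`. [cite: Serre1973, Ch. IV §2.1 Thm. 5] -/
theorem mul_sq_left (a b c : K) (ha : a ≠ 0) (hb : b ≠ 0) (hc : c ≠ 0) :
    s (a * c ^ 2) b = s a b := by
  rw [sq, hs.mul_left a (c * c) b ha (mul_ne_zero hc hc) hb, hs.mul_left c c b hc hc hb,
    hs.mul_self c b hc hb, mul_one]

/-- A Hasse symbol only depends on square classes: `s a (b c²) = s a b`. [cite: Serre1973, Ch. IV §2.1 Thm. 5] -/
theorem mul_sq_right (a b c : K) (ha : a ≠ 0) (hb : b ≠ 0) (hc : c ≠ 0) :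
    s a (b * c ^ 2) = s a b := by
  rw [hs.comm, hs.mul_sq_left b a c hb ha hc, hs.comm]

/-- `s a (∏ bⱼ) = ∏ s a bⱼ` for nonzero arguments. [cite: Serre1973, Ch. IV §2.1 Thm. 5] -/
theorem map_prod_right (a : K) (ha : a ≠ 0) {k : ℕ} (b : Fin k → K) (hb : ∀ j, b j ≠ 0) :
    s a (∏ j, b j) = ∏ j, s a (b j) := by
  induction k with
  | zero =>
    simp only [univ_eq_empty, prod_empty]
    have h1 := hs.mul_self 1 a one_ne_zero ha
    have h2 := hs.mul_left 1 1 a one_ne_zero one_ne_zero ha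
    rw [one_mul] at h2
    rw [hs.comm]
    -- `s 1 a = s 1 a * s 1 a = 1`
    rw [← h1]; exact h2
  | succ k ih =>
    rw [Fin.prod_univ_succ, Fin.prod_univ_succ, hs.mul_right a _ _ ha (hb 0)
      (prod_ne_zero_iff.mpr fun j _ => hb j.succ), ih (fun j => b j.succ) fun j => hb j.succ]

end IsHasseSymbol

/-- Square-class invariance of the Hasse product, entrywise: if `a' i = a i * c i ^ 2` with all
`a i, c i ≠ 0`, the Hasse products agree. [cite: Serre1973, Ch. IV §2.1 Thm. 5] -/
theorem hasseProd_congr_sq {s : K → K → ℤ} (hs : IsHasseSymbol s) {k : ℕ} (a a' c : Fin k → K)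
    (ha : ∀ i, a i ≠ 0) (hc : ∀ i, c i ≠ 0) (h : ∀ i, a' i = a i * c i ^ 2) :
    hasseProd s a' = hasseProd s a := by
  unfold hasseProd
  refine prod_congr rfl fun i _ => prod_congr rfl fun j _ => ?_
  split_ifs
  · rw [h i, h j, hs.mul_sq_left _ _ _ (ha i) (mul_ne_zero (ha j) (pow_ne_zero 2 (hc j))) (hc i),
      hs.mul_sq_right _ _ _ (ha i) (ha j) (hc j)]
  · rfl

/-! ### Frames (orthogonal bases of their span) -/

variable {W : Type*} [AddCommGroup W] [Module K W]

/-- A **frame** for a bilinear form `B` is a finite family of pairwise `B`-orthogonal vectors of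
nonzero square — an orthogonal basis (Serre, Ch. IV §1.4 Def. 5) of the subspace it spans, on
which `B` is then nondegenerate. [cite: Serre1973, Ch. IV §1.4 Def. 5] -/
structure IsFrame (B : LinearMap.BilinForm K W) {k : ℕ} (f : Fin k → W) : Prop where
  /-- pairwise orthogonality -/
  ortho : ∀ i j, i ≠ j → B (f i) (f j) = 0
  /-- nonzero squares -/
  ne_zero : ∀ i, B (f i) (f i) ≠ 0

namespace IsFrame

variable {B : LinearMap.BilinForm K W} {k : ℕ} {f : Fin k → W}

/-- A subfamily of a frame (along an injective reindexing) is a frame. [folklore] -/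
theorem comp (hf : IsFrame B f) {l : ℕ} (e : Fin l → Fin k) (he : Function.Injective e) :
    IsFrame B (f ∘ e) :=
  ⟨fun _ _ hij => hf.ortho _ _ fun h => hij (he h), fun _ => hf.ne_zero _⟩

/-- Pairing a linear combination of a frame with a frame vector picks out one coefficient:
`B (∑ cᵢ fᵢ) fⱼ = cⱼ (fⱼ.fⱼ)`. [folklore] -/
theorem apply_sum_smul (hf : IsFrame B f) (c : Fin k → K) (j : Fin k) :
    B (∑ i, c i • f i) (f j) = c j * B (f j) (f j) := by
  rw [map_sum, LinearMap.sum_apply]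
  simp only [map_smul, LinearMap.smul_apply, smul_eq_mul]
  rw [sum_eq_single j]
  · intro i _ hij
    rw [hf.ortho i j hij, mul_zero]
  · intro h; exact absurd (mem_univ j) h

/-- In a frame, the coefficients of a vector of the span are `(w.fⱼ)/(fⱼ.fⱼ)`:
`w = ∑ⱼ (w.fⱼ / fⱼ.fⱼ) fⱼ`. [cite: Serre1973, Ch. IV §1.4 Def. 5] -/
theorem eq_sum_smul (hf : IsFrame B f) {w : W} (hw : w ∈ Submodule.span K (Set.range f)) :
    w = ∑ j, (B w (f j) / B (f j) (f j)) • f j := by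
  obtain ⟨c, rfl⟩ := (Submodule.mem_span_range_iff_exists_fun K).mp hw
  refine sum_congr rfl fun j _ => ?_
  rw [hf.apply_sum_smul c j, mul_div_cancel_right₀ _ (hf.ne_zero j)]

/-- A vector of the span of a frame which is orthogonal to every frame vector is zero (the form is
nondegenerate on the span). [folklore] -/
theorem eq_zero_of_forall_ortho (hf : IsFrame B f) {w : W} (hw : w ∈ Submodule.span K (Set.range f))
    (h0 : ∀ j, B w (f j) = 0) : w = 0 := by
  rw [hf.eq_sum_smul hw]
  exact sum_eq_zero fun j _ => by rw [h0 j, zero_div, zero_smul]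

/-- The square of a vector of the span of a frame: `w.w = ∑ⱼ cⱼ² (fⱼ.fⱼ)` with
`cⱼ = w.fⱼ / fⱼ.fⱼ`. [folklore] -/
theorem apply_self_eq_sum (hf : IsFrame B f) {w : W}
    (hw : w ∈ Submodule.span K (Set.range f)) :
    B w w = ∑ j, (B w (f j) / B (f j) (f j)) ^ 2 * B (f j) (f j) := by
  have h := hf.eq_sum_smul hw
  calc B w w = B w (∑ j, (B w (f j) / B (f j) (f j)) • f j) := congrArg (B w) h
    _ = ∑ j, (B w (f j) / B (f j) (f j)) * B w (f j) := by
      rw [map_sum]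
      exact sum_congr rfl fun j _ => by rw [map_smul, smul_eq_mul]
    _ = ∑ j, (B w (f j) / B (f j) (f j)) ^ 2 * B (f j) (f j) :=
      sum_congr rfl fun j _ => by rw [sq, mul_assoc, div_mul_cancel₀ _ (hf.ne_zero j)]

end IsFrame

/-- **The discriminant of a frame is well defined up to squares**: if every vector of a frame `f'`
lies in the span of a frame `f` of the same size, then `∏ (f'ᵢ.f'ᵢ) = (∏ (fᵢ.fᵢ)) c²` for some
`c ≠ 0` (the determinant of the transition matrix: `diag(a') = P diag(a) Pᵀ`). Serre, Ch. IV §1.1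
(the discriminant `d(Q) = a₁ ⋯ aₙ ∈ k*/k*²`). [cite: Serre1973, Ch. IV §1.1] -/
theorem exists_prod_eq_prod_mul_sq {B : LinearMap.BilinForm K W} (hB : B.IsSymm) {k : ℕ}
    {f f' : Fin k → W} (hf : IsFrame B f) (hf' : IsFrame B f')
    (h : ∀ i, f' i ∈ Submodule.span K (Set.range f)) :
    ∃ c : K, c ≠ 0 ∧ ∏ i, B (f' i) (f' i) = (∏ i, B (f i) (f i)) * c ^ 2 := by
  classical
  -- transition coefficients
  set P : Matrix (Fin k) (Fin k) K := fun i j => B (f' i) (f j) / B (f j) (f j) with hP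
  have hrepr : ∀ i, f' i = ∑ j, P i j • f j := fun i => hf.eq_sum_smul (h i)
  have hPN : ∀ i j, P i j * B (f j) (f j) = B (f' i) (f j) := fun i j =>
    div_mul_cancel₀ _ (hf.ne_zero j)
  have hgram : ∀ i i', B (f' i) (f' i') = ∑ j, P i j * P i' j * B (f j) (f j) := by
    intro i i'
    calc B (f' i) (f' i') = B (∑ j, P i j • f j) (f' i') := by rw [← hrepr i]
      _ = ∑ j, P i j * B (f j) (f' i') := by
        rw [map_sum, LinearMap.sum_apply]
        exact sum_congr rfl fun j _ => by rw [map_smul, LinearMap.smul_apply, smul_eq_mul]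
      _ = ∑ j, P i j * P i' j * B (f j) (f j) :=
        sum_congr rfl fun j _ => by rw [hB.eq (f j), mul_assoc, hPN i' j]
  have hmat : Matrix.diagonal (fun i => B (f' i) (f' i)) =
      P * Matrix.diagonal (fun j => B (f j) (f j)) * P.transpose := by
    ext i i'
    rw [Matrix.mul_assoc, Matrix.mul_apply]
    simp only [Matrix.diagonal_mul, Matrix.transpose_apply, Matrix.diagonal_apply]
    split_ifs with hii
    · subst hii
      rw [hgram]
      exact sum_congr rfl fun j _ => by ring
    · have := hf'.ortho i i' hii
      rw [hgram] at this
      rw [← this]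
      exact sum_congr rfl fun j _ => by ring
  have hdet := congrArg Matrix.det hmat
  rw [Matrix.det_diagonal, Matrix.det_mul, Matrix.det_mul, Matrix.det_diagonal,
    Matrix.det_transpose] at hdet
  refine ⟨P.det, fun h0 => ?_, by rw [hdet]; ring⟩
  rw [h0, mul_zero] at hdet
  exact prod_ne_zero_iff.mpr (fun i _ => hf'.ne_zero i) hdet


/-! ### Replacing vectors of a frame -/

section Update

variable {B : LinearMap.BilinForm K W} {k : ℕ} {f : Fin k → W}

/-- Two families spanning each other's members have the same span. [folklore] -/
theorem span_range_eq_of_mem {l : ℕ} {g : Fin l → W}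
    (hg : ∀ a, g a ∈ Submodule.span K (Set.range f))
    (hf : ∀ a, f a ∈ Submodule.span K (Set.range g)) :
    Submodule.span K (Set.range g) = Submodule.span K (Set.range f) :=
  le_antisymm (Submodule.span_le.mpr (Set.range_subset_iff.mpr hg))
    (Submodule.span_le.mpr (Set.range_subset_iff.mpr hf))

/-- Replacing one vector of a frame by a vector of nonzero square orthogonal to the others gives
a frame. [folklore] -/
theorem IsFrame.update (hB : B.IsSymm) (hf : IsFrame B f) (i : Fin k) {u : W}
    (hu : ∀ l, l ≠ i → B u (f l) = 0) (hNu : B u u ≠ 0) :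
    IsFrame B (Function.update f i u) := by
  constructor
  · intro a b hab
    simp only [Function.update_apply]
    by_cases ha : a = i
    · subst ha
      rw [if_pos rfl, if_neg (Ne.symm hab)]
      exact hu b (Ne.symm hab)
    · rw [if_neg ha]
      by_cases hb : b = i
      · subst hb
        rw [if_pos rfl, hB.eq, hu a ha]
      · rw [if_neg hb]
        exact hf.ortho a b hab
  · intro a
    simp only [Function.update_apply]
    by_cases ha : a = i
    · subst ha; rw [if_pos rfl]; exact hNu
    · rw [if_neg ha]; exact hf.ne_zero a

/-- Replacing two vectors `fᵢ, fⱼ` of a frame by orthogonal vectors `u ⊥ u'` of nonzero square,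
both orthogonal to the remaining frame vectors, gives a frame. [folklore] -/
theorem IsFrame.update_update (hB : B.IsSymm) (hf : IsFrame B f) {i j : Fin k} (hij : i ≠ j)
    {u u' : W} (huu' : B u u' = 0) (hu : ∀ l, l ≠ i → l ≠ j → B u (f l) = 0)
    (hu' : ∀ l, l ≠ i → l ≠ j → B u' (f l) = 0) (hNu : B u u ≠ 0) (hNu' : B u' u' ≠ 0) :
    IsFrame B (Function.update (Function.update f i u) j u') := by
  -- values of the new family
  have hval : ∀ a, Function.update (Function.update f i u) j u' a =
      if a = j then u' else if a = i then u else f a := fun a => by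
    simp only [Function.update_apply]
  constructor
  · intro a b hab
    rw [hval a, hval b]
    by_cases haj : a = j
    · subst haj
      rw [if_pos rfl, if_neg (Ne.symm hab)]
      by_cases hbi : b = i
      · subst hbi; rw [if_pos rfl, hB.eq]; exact huu'
      · rw [if_neg hbi]; exact hu' b hbi (Ne.symm hab)
    · rw [if_neg haj]
      by_cases hai : a = i
      · subst hai
        rw [if_pos rfl]
        by_cases hbj : b = j
        · subst hbj; rw [if_pos rfl]; exact huu'
        · rw [if_neg hbj, if_neg (Ne.symm hab)]; exact hu b (Ne.symm hab) hbj
      · rw [if_neg hai]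
        by_cases hbj : b = j
        · subst hbj; rw [if_pos rfl, hB.eq]; exact hu' a hai haj
        · rw [if_neg hbj]
          by_cases hbi : b = i
          · subst hbi; rw [if_pos rfl, hB.eq]; exact hu a hai haj
          · rw [if_neg hbi]; exact hf.ortho a b hab
  · intro a
    rw [hval a]
    by_cases haj : a = j
    · subst haj; rw [if_pos rfl]; exact hNu'
    · rw [if_neg haj]
      by_cases hai : a = i
      · subst hai; rw [if_pos rfl]; exact hNu
      · rw [if_neg hai]; exact hf.ne_zero a

end Update

end Literature.NumberTheory.QuadraticForms
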